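import Mathlib
import HarnessLib
import Summits.Parity.GeneralizedHardyLittlewood.Theorems.LeeYangFibresModelHyperbolicity
import Summits.Parity.GeneralizedHardyLittlewood.Theorems.LeeYangFibresFibreHyperbolicityLawOneAnalyticAux

/-!
# Stub `stub_lawOneAnalytic` of line `SketchIdeator1` (model transfer) for crux
# `LeeYangFibres.FibreHyperbolicity` (stmt-Parity-14108)

We prove `APCellAsymptotic → SegmentLawOne` (both unfolded): Alladi's Ω-cell asymptotic for the rough
integers of a fixed residue class `r mod q` in the `(X, Y)`-format (the hypothesis; little-o form, uniform in
the reduced class) implies the SEGMENT LAW for one progression: for `q ≤ L`, threshold `z = N^{1/u}`, a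
segment `(M₁, M₂] ⊆ (0, LN]` of length `≥ ηN` and `1 ≤ j ≤ u`,
`#{m ∈ (M₁, M₂] : m ≡ r (q), z < P⁻(m), Ω(m) = j} = Λ₀ I_j(u) (1 ± ε)` for `j < u` and `≤ ε Λ₀` for
`j = u`, where `Λ₀ = (M₂ - M₁)/(φ(q) log N)` and `I_j(u) = cellDensity (j-1) u`.

Proof (pure real analysis on top of the hypothesis).
* Threshold: `z < P⁻(m) ↔ ⌈Y⌉₊ ≤ P⁻(m)` with the INTEGER `Y = ⌊z⌋₊ + 1`, `z < Y ≤ z + 1`, so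
  `log N ≤ u log Y ≤ log N + u`.
* `#{m ∈ (M₁, M₂] : …} = A(M₂) - A(M₁)` with `A(X) = #{n ≤ X : …}`; it suffices to bound, for every
  natural `X ≤ LN`, the pointwise defect `E(X) = A(X) - X I(u)/(φ log N) + [j=1] Y/(φ log Y)` by
  `κ N/(φ log N)`, `κ = ε c η/2` (`c > 0` a common lower bound of the `I_j(u)`, `j < u`, and of `1`):
  the secondary terms cancel in the difference and `2κN ≤ ε c (M₂ - M₁)`.
* For `X ≥ max(X₀, Y)` the hypothesis (with `k = u + 1`, accuracy `ε_AP`) applies at `(X, Y)` since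
  `log X ≤ log L + log N ≤ (u+1) log Y` once `N ≥ L^u`; then
  `E(X) = O(ε_AP X/log Y) + (X/φ)(I(v_X)/log X - I(u)/log N)`, `v_X = log X/log Y ∈ [1, u+1]`, and
  `X (I(v_X) - I(u))/log X` is small either because `X ≤ δN` (densities bounded by `B` on `[0, u+1]`)
  or because `|v_X - u| ≤ u(|log δ| + |log L| + u)/log N` is small (continuity of the densities at `u`),
  while `X I(u) |1/log X - 1/log N| ≤ B (1 + L²) u N/log² N` (`X |log N - log X| ≤ (1 + L²) N`).
* For `X < max(X₀, Y)` the trivial bound `A(X) ≤ X ≤ X₀ + z + 1 = O(√N)` suffices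
  (`log N ≤ 4 N^{1/4}`).
All thresholds in `N` are collected with `Filter.atTop` (`N ≥ 2`, `N ≥ L^u`, `log N ≥ C₂`, `N^{1/4} ≥ C₃`);
the threshold `X₀` of the hypothesis is made uniform over `q ≤ L`, `i < u` by a finite sum.
The generic lemmas (tag `loa_`: threshold, counting, densities, elementary inequalities, the algebra of the
two ranges) are in `LeeYangFibresFibreHyperbolicityLawOneAnalyticAux.lean`; here only the pointwise defect
bound `loa_pointwise` and the registered stub.

References: K. Alladi, Quart. J. Math. Oxford (2) 33 (1982) 129–148; G. Tenenbaum, *Introduction to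
analytic and probabilistic number theory*, III.6 (context only; no named facts are used).
-/

namespace Summit.Parity.GeneralizedHardyLittlewood.Cruxes.FibreHyperbolicity.ModelTransfer

open scoped BigOperators Classical
open Finset Polynomial
open Literature.NumberTheory.Sieve
open Summit.Parity.GeneralizedHardyLittlewood.Cruxes.ModelHyperbolicity.WindowChainTransport (cellDensity)
open Summit.Parity.GeneralizedHardyLittlewood.Cruxes.ModelHyperbolicity.WindowChainTransport (calc_nonneg)

/-! ## The pointwise defect bound (the heart of the matter) -/

/-- **Pointwise defect.** Under the hypothesis `APCellAsymptotic` (unfolded): for `N ≥ N₀(L, u, κ)`, every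
`q ≤ L`, `r` prime to `q`, `i < u` and every natural `X ≤ LN`,
`|A(X) - X I_{i+1}(u)/(φ(q) log N) + [i=0] Y/(φ(q) log Y)| ≤ κ N/(φ(q) log N)`, where
`A(X) = #{n ≤ X : n ≡ r (q), N^{1/u} < P⁻(n), Ω(n) = i+1}` and `Y = ⌊N^{1/u}⌋₊ + 1`. -/
private theorem loa_pointwise
    (H : ∀ q : ℕ, 1 ≤ q → ∀ i k : ℕ, ∀ ε : ℝ, 0 < ε → ∃ X₀ : ℝ, ∀ r : ℕ, r.Coprime q →
      ∀ X Y : ℝ, 2 ≤ Y → Y ≤ X → X₀ ≤ X → Real.log X ≤ k * Real.log Y →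
        |((((Finset.Icc 1 ⌊X⌋₊).filter (fun n => n ≡ r [MOD q] ∧ ⌈Y⌉₊ ≤ Nat.minFac n ∧
              ArithmeticFunction.cardFactors n = i + 1)).card : ℕ) : ℝ) -
            (X * cellDensity i (Real.log X / Real.log Y) / Real.log X -
                if i = 0 then Y / Real.log Y else 0) / (Nat.totient q : ℝ)| ≤
          ε * X / Real.log Y)
    (L u : ℕ) (hu : 2 ≤ u) {κ : ℝ} (hκ : 0 < κ) :
    ∃ N₀ : ℕ, ∀ N : ℕ, N₀ ≤ N → 2 ≤ N ∧ ∀ q r : ℕ, 1 ≤ q → q ≤ L → r.Coprime q → ∀ i : ℕ, i < u →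
      ∀ X : ℕ, (X : ℝ) ≤ L * N →
        |((((Finset.Icc 1 X).filter (fun n => n ≡ r [MOD q] ∧
              (N : ℝ) ^ ((1 : ℝ) / u) < (Nat.minFac n : ℝ) ∧
              ArithmeticFunction.cardFactors n = i + 1)).card : ℕ) : ℝ) -
            X * cellDensity i u / ((Nat.totient q : ℝ) * Real.log N) +
            (if i = 0 then (((⌊(N : ℝ) ^ ((1 : ℝ) / u)⌋₊ + 1 : ℕ) : ℝ)) /
                Real.log (((⌊(N : ℝ) ^ ((1 : ℝ) / u)⌋₊ + 1 : ℕ) : ℝ)) else 0) / (Nat.totient q : ℝ)| ≤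
          κ * N / ((Nat.totient q : ℝ) * Real.log N) := by
  -- constants depending on `L, u, κ` only
  obtain ⟨B, hB1, hB⟩ := loa_dens_bound u
  have hB0 : 0 < B := by linarith
  have hu0 : (0 : ℝ) < u := by exact_mod_cast (show 0 < u by omega)
  have hu2 : (2 : ℝ) ≤ u := by exact_mod_cast hu
  have hL0 : (0 : ℝ) ≤ L := Nat.cast_nonneg L
  obtain ⟨ε₁, hε₁⟩ : ∃ ε₁ : ℝ, ε₁ = κ / (4 * ((L : ℝ) + 1) * u) := ⟨_, rfl⟩
  have hε₁0 : 0 < ε₁ := by rw [hε₁]; positivity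
  obtain ⟨δ, hδ⟩ : ∃ δ : ℝ, δ = κ / (4 * B * u) := ⟨_, rfl⟩
  have hδ0 : 0 < δ := by rw [hδ]; positivity
  obtain ⟨εAP, hεAP⟩ : ∃ εAP : ℝ, εAP = κ / (2 * ((L : ℝ) + 1) ^ 2 * u) := ⟨_, rfl⟩
  have hεAP0 : 0 < εAP := by rw [hεAP]; positivity
  have hε₁le : ε₁ * L * u ≤ κ / 4 := by
    have h1 : ε₁ * ((L : ℝ) + 1) * u = κ / 4 := by
      rw [hε₁, div_mul_eq_mul_div, div_mul_eq_mul_div, div_eq_div_iff (by positivity) (by norm_num)]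
      ring
    have h2 : ε₁ * (L : ℝ) * u ≤ ε₁ * ((L : ℝ) + 1) * u :=
      mul_le_mul_of_nonneg_right (mul_le_mul_of_nonneg_left (by linarith) hε₁0.le) hu0.le
    linarith
  have hδle : δ * B * u ≤ κ / 4 := by
    rw [hδ, div_mul_eq_mul_div, div_mul_eq_mul_div, div_le_div_iff₀ (by positivity) (by norm_num)]
    exact le_of_eq (by ring)
  have hεAPle : εAP * (L : ℝ) ^ 2 * u ≤ κ / 2 := by
    have h1 : εAP * ((L : ℝ) + 1) ^ 2 * u = κ / 2 := by
      rw [hεAP, div_mul_eq_mul_div, div_mul_eq_mul_div, div_eq_div_iff (by positivity) (by norm_num)]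
      ring
    have hsq : (L : ℝ) ^ 2 ≤ ((L : ℝ) + 1) ^ 2 := by gcongr; linarith
    have h2 : εAP * (L : ℝ) ^ 2 * u ≤ εAP * ((L : ℝ) + 1) ^ 2 * u :=
      mul_le_mul_of_nonneg_right (mul_le_mul_of_nonneg_left hsq hεAP0.le) hu0.le
    linarith
  obtain ⟨ρ, hρ, hmod⟩ := loa_dens_modulus u ε₁ hε₁0
  -- a uniform threshold `X₀` for the hypothesis over `q ≤ L`, `i < u` (with `k = u + 1`, accuracy `εAP`)
  choose! f hf using H
  obtain ⟨X₀, hX₀⟩ : ∃ X₀ : ℝ, X₀ = ∑ q ∈ Finset.range (L + 1), ∑ i ∈ Finset.range u, |f q i (u + 1) εAP| :=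
    ⟨_, rfl⟩
  have hX₀0 : 0 ≤ X₀ := by
    rw [hX₀]
    exact Finset.sum_nonneg fun q _ => Finset.sum_nonneg fun i _ => abs_nonneg _
  have hfX₀ : ∀ q, q ≤ L → ∀ i, i < u → f q i (u + 1) εAP ≤ X₀ := by
    intro q hq i hi
    rw [hX₀]
    calc f q i (u + 1) εAP ≤ |f q i (u + 1) εAP| := le_abs_self _
      _ ≤ ∑ i' ∈ Finset.range u, |f q i' (u + 1) εAP| :=
          Finset.single_le_sum (f := fun i' => |f q i' (u + 1) εAP|) (fun _ _ => abs_nonneg _)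
            (Finset.mem_range.mpr hi)
      _ ≤ ∑ q' ∈ Finset.range (L + 1), ∑ i' ∈ Finset.range u, |f q' i' (u + 1) εAP| :=
          Finset.single_le_sum (f := fun q' => ∑ i' ∈ Finset.range u, |f q' i' (u + 1) εAP|)
            (fun _ _ => Finset.sum_nonneg fun _ _ => abs_nonneg _) (Finset.mem_range.mpr (by omega))
  -- the thresholds in `N`
  obtain ⟨D, hD⟩ : ∃ D : ℝ, D = |Real.log δ| + |Real.log (L : ℝ)| := ⟨_, rfl⟩
  obtain ⟨C₂, hC₂⟩ : ∃ C₂ : ℝ, C₂ = max (u * (D + u) / ρ) (4 * B * (1 + (L : ℝ) ^ 2) * u / κ) :=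
    ⟨_, rfl⟩
  obtain ⟨C₃, hC₃⟩ : ∃ C₃ : ℝ, C₃ = (X₀ + 2) * (4 * L + B + u) / κ := ⟨_, rfl⟩
  have e1 : ∀ᶠ N : ℕ in Filter.atTop, 2 ≤ N := Filter.eventually_ge_atTop 2
  have e2 : ∀ᶠ N : ℕ in Filter.atTop, L ^ u ≤ N := Filter.eventually_ge_atTop _
  have e3 : ∀ᶠ N : ℕ in Filter.atTop, C₂ ≤ Real.log N :=
    (Real.tendsto_log_atTop.comp tendsto_natCast_atTop_atTop).eventually_ge_atTop C₂
  have e4 : ∀ᶠ N : ℕ in Filter.atTop, C₃ ≤ (N : ℝ) ^ ((1 : ℝ) / 4) :=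
    ((tendsto_rpow_atTop (by norm_num : (0 : ℝ) < 1 / 4)).comp
      tendsto_natCast_atTop_atTop).eventually_ge_atTop C₃
  obtain ⟨N₀, hN₀⟩ := Filter.eventually_atTop.mp (e1.and (e2.and (e3.and e4)))
  refine ⟨N₀, fun N hN => ?_⟩
  obtain ⟨hN2, hNL, hNC₂, hNC₃⟩ := hN₀ N hN
  refine ⟨hN2, ?_⟩
  intro q r hq hqL hr i hi X hXL
  -- basic quantities at this `N`
  have hN1 : 1 ≤ N := by omega
  have hN0 : (0 : ℝ) < N := by exact_mod_cast (show 0 < N by omega)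
  have hY2 : (2 : ℝ) ≤ ((⌊(N : ℝ) ^ ((1 : ℝ) / u)⌋₊ + 1 : ℕ) : ℝ) := loa_two_le_Y u hN1
  have hℓY : Real.log N ≤ u * Real.log (((⌊(N : ℝ) ^ ((1 : ℝ) / u)⌋₊ + 1 : ℕ) : ℝ)) :=
    loa_log_le (by omega) hN1
  have hYℓ : u * Real.log (((⌊(N : ℝ) ^ ((1 : ℝ) / u)⌋₊ + 1 : ℕ) : ℝ)) ≤ Real.log N + u :=
    loa_log_Y_le (by omega) hN1
  have hz1 : 1 ≤ (N : ℝ) ^ ((1 : ℝ) / u) := loa_one_le_z u hN1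
  have hYz : (((⌊(N : ℝ) ^ ((1 : ℝ) / u)⌋₊ + 1 : ℕ) : ℝ)) ≤ (N : ℝ) ^ ((1 : ℝ) / u) + 1 := loa_Y_le u N
  have hℓ0 : 0 < Real.log N := Real.log_pos (by exact_mod_cast (show 1 < N by omega))
  have hφ0 : (0 : ℝ) < (Nat.totient q : ℝ) := by exact_mod_cast Nat.totient_pos.mpr (by omega)
  have hφL : (Nat.totient q : ℝ) ≤ L := by exact_mod_cast (Nat.totient_le q).trans hqL
  have hIu0 : 0 ≤ cellDensity i u := calc_nonneg i u
  have hIuB : cellDensity i u ≤ B := hB i hi u hu0.le (by linarith)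
  have hX0 : (0 : ℝ) ≤ X := Nat.cast_nonneg X
  -- `u log L ≤ log N` (from `N ≥ L^u`)
  have hlogL : u * Real.log (L : ℝ) ≤ Real.log N := by
    rcases Nat.eq_zero_or_pos L with hL | hL
    · rw [hL, Nat.cast_zero, Real.log_zero, mul_zero]
      exact hℓ0.le
    · have hLr0 : (0 : ℝ) < L := by exact_mod_cast hL
      have h : (L : ℝ) ^ u ≤ N := by exact_mod_cast hNL
      rw [← Real.log_pow]
      exact Real.log_le_log (by positivity) h
  -- rewrite the count with the integer threshold, then name `Y` and the count
  have hfilter : ((Finset.Icc 1 X).filter (fun n => n ≡ r [MOD q] ∧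
      (N : ℝ) ^ ((1 : ℝ) / u) < (Nat.minFac n : ℝ) ∧ ArithmeticFunction.cardFactors n = i + 1)) =
      ((Finset.Icc 1 ⌊((X : ℕ) : ℝ)⌋₊).filter (fun n => n ≡ r [MOD q] ∧
        ⌈(((⌊(N : ℝ) ^ ((1 : ℝ) / u)⌋₊ + 1 : ℕ) : ℝ))⌉₊ ≤ Nat.minFac n ∧
        ArithmeticFunction.cardFactors n = i + 1)) := by
    rw [Nat.floor_natCast]
    refine Finset.filter_congr fun n _ => ?_
    rw [loa_thr_iff u N n]
  rw [hfilter]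
  generalize hYdef : (((⌊(N : ℝ) ^ ((1 : ℝ) / u)⌋₊ + 1 : ℕ) : ℝ)) = Y at hY2 hℓY hYℓ hYz ⊢
  have hY0 : 0 < Y := by linarith
  have hLY0 : 0 < Real.log Y := Real.log_pos (by linarith)
  have haX : ((((Finset.Icc 1 ⌊((X : ℕ) : ℝ)⌋₊).filter (fun n => n ≡ r [MOD q] ∧
      ⌈Y⌉₊ ≤ Nat.minFac n ∧ ArithmeticFunction.cardFactors n = i + 1)).card : ℕ) : ℝ) ≤ X := by
    rw [Nat.floor_natCast]
    exact loa_count_le _ X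
  generalize ha : ((((Finset.Icc 1 ⌊((X : ℕ) : ℝ)⌋₊).filter (fun n => n ≡ r [MOD q] ∧
      ⌈Y⌉₊ ≤ Nat.minFac n ∧ ArithmeticFunction.cardFactors n = i + 1)).card : ℕ) : ℝ) = a at haX ⊢
  have ha0 : 0 ≤ a := by rw [← ha]; exact Nat.cast_nonneg _
  -- the secondary term
  have hS0 : 0 ≤ (if i = 0 then Y / Real.log Y else 0 : ℝ) := by
    split_ifs
    · positivity
    · exact le_rfl
  have hSY : (if i = 0 then Y / Real.log Y else 0 : ℝ) ≤ Y * u / Real.log N := by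
    have h : Y / Real.log Y ≤ Y * u / Real.log N := by
      rw [div_le_div_iff₀ hLY0 hℓ0]
      calc Y * Real.log N ≤ Y * (u * Real.log Y) := mul_le_mul_of_nonneg_left hℓY hY0.le
        _ = Y * u * Real.log Y := by ring
    split_ifs
    · exact h
    · positivity
  by_cases hcase : f q i (u + 1) εAP ≤ X ∧ Y ≤ X
  · -- Case `X ≥ max(X₀, Y)`: the asymptotic of the hypothesis applies at `(X, Y)` with `k = u + 1`
    obtain ⟨hfX, hYX⟩ := hcase
    have hXpos : (0 : ℝ) < X := by linarith
    have hLr0 : (0 : ℝ) < L := (mul_pos_iff_of_pos_right hN0).mp (hXpos.trans_le hXL)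
    have hLYlX : Real.log Y ≤ Real.log X := Real.log_le_log hY0 hYX
    have hlX0 : 0 < Real.log X := by linarith
    have hℓX : Real.log N ≤ u * Real.log X :=
      hℓY.trans (mul_le_mul_of_nonneg_left hLYlX hu0.le)
    have hlXup : Real.log X ≤ ((u + 1 : ℕ) : ℝ) * Real.log Y := by
      have h1 : Real.log X ≤ Real.log L + Real.log N := by
        rw [← Real.log_mul hLr0.ne' hN0.ne']
        exact Real.log_le_log hXpos hXL
      have h3 : Real.log (L : ℝ) ≤ Real.log Y := le_of_mul_le_mul_left (hlogL.trans hℓY) hu0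
      push_cast
      linarith
    have hHX := hf q hq i (u + 1) εAP hεAP0 r hr (X : ℝ) Y hY2 hYX hfX hlXup
    rw [ha] at hHX
    -- `v = log X / log Y ∈ [0, u + 1]`
    have hv0 : 0 ≤ Real.log X / Real.log Y := by positivity
    have hv1 : Real.log X / Real.log Y ≤ u + 1 := by
      rw [div_le_iff₀ hLY0]
      exact_mod_cast hlXup
    have hIv0 : 0 ≤ cellDensity i (Real.log X / Real.log Y) := calc_nonneg i _
    have hIvB : cellDensity i (Real.log X / Real.log Y) ≤ B := hB i hi _ hv0 hv1
    -- the three estimates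
    have h3 : |X * (cellDensity i (Real.log X / Real.log Y) - cellDensity i u) / Real.log X| ≤
        κ / 4 * N / Real.log N := by
      rcases le_or_gt (X : ℝ) (δ * N) with hXδ | hXδ
      · exact loa_h3_near hX0 hXδ hδ0.le hN0.le hIv0 hIvB hIu0 hIuB hlX0 hℓ0 hℓX hδle
      · have hDX : |Real.log X - Real.log N| ≤ D := by
          rw [hD]
          exact loa_logdiff_le hXpos hN0 hδ0 hXδ.le hXL
        have hv : |Real.log X / Real.log Y - u| ≤ ρ := by
          have h1 := loa_vdiff hLY0 hℓ0 hℓY hYℓ hu0.le hDX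
          have hC : u * (D + u) / ρ ≤ Real.log N := by
            have h := le_max_left (u * (D + u) / ρ) (4 * B * (1 + (L : ℝ) ^ 2) * u / κ)
            rw [← hC₂] at h
            exact h.trans hNC₂
          rw [div_le_iff₀ hρ] at hC
          refine h1.trans ?_
          rw [div_le_iff₀ hℓ0]
          linarith [mul_comm ρ (Real.log N)]
        exact loa_h3_far hX0 hXL hN0.le hL0 (hmod i hi _ hv) hlX0 hℓ0 hℓX hε₁le
    have h4 : |X * cellDensity i u * (1 / Real.log X - 1 / Real.log N)| ≤ κ / 4 * N / Real.log N := by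
      have hxl : (X : ℝ) * |Real.log N - Real.log X| ≤ (1 + (L : ℝ) ^ 2) * N :=
        loa_xlog_le hXpos hN0 hXL
      have hC : 4 * B * (1 + (L : ℝ) ^ 2) * u / κ ≤ Real.log N := by
        have h := le_max_right (u * (D + u) / ρ) (4 * B * (1 + (L : ℝ) ^ 2) * u / κ)
        rw [← hC₂] at h
        exact h.trans hNC₂
      rw [div_le_iff₀ hκ] at hC
      exact loa_h4 hX0 hN0.le hxl hIu0 hIuB hlX0 hℓ0 hℓX hu0 hκ.le
        (by linarith [mul_comm κ (Real.log N)])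
    have h2 : εAP * X / Real.log Y ≤ κ / 2 * N / ((Nat.totient q : ℝ) * Real.log N) :=
      loa_h2 hXL hN0.le hL0 hLY0 hℓ0 hℓY hφ0 hφL hεAP0.le hεAPle
    exact loa_case2 hφ0 hℓ0 hlX0 hHX h2 h3 h4
  · -- Case `X < max(X₀, Y)`: trivial bound
    have hXsmall : (X : ℝ) ≤ X₀ + (N : ℝ) ^ ((1 : ℝ) / u) + 1 := by
      rcases not_and_or.mp hcase with h | h
      · have h' := not_le.mp h
        linarith [hfX₀ q hqL i hi]
      · have h' := not_le.mp h
        linarith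
    -- the threshold condition `X₁ (L ℓ + B + u) ≤ κ N`, via `w = N^{1/4}`
    have hC1 : (X₀ + (N : ℝ) ^ ((1 : ℝ) / u) + 1) * (L * Real.log N + B + u) ≤ κ * N := by
      obtain ⟨w, hw⟩ : ∃ w : ℝ, w = (N : ℝ) ^ ((1 : ℝ) / 4) := ⟨_, rfl⟩
      have hw1 : 1 ≤ w := by
        rw [hw]
        exact Real.one_le_rpow (by exact_mod_cast hN1) (by norm_num)
      have hw0 : 0 ≤ w := zero_le_one.trans hw1
      have hNw : (N : ℝ) = w ^ 4 := by
        rw [hw, ← Real.rpow_natCast, ← Real.rpow_mul hN0.le]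
        norm_num
      have hzw : (N : ℝ) ^ ((1 : ℝ) / u) ≤ w ^ 2 := by
        have h2 : w ^ 2 = (N : ℝ) ^ ((1 : ℝ) / 2) := by
          rw [hw, ← Real.rpow_natCast, ← Real.rpow_mul hN0.le]
          norm_num
        rw [h2]
        refine Real.rpow_le_rpow_of_exponent_le (by exact_mod_cast hN1) ?_
        rw [div_le_div_iff₀ hu0 two_pos]
        linarith
      have hℓw : Real.log N ≤ 4 * w := by
        have h := Real.log_le_rpow_div hN0.le (by norm_num : (0 : ℝ) < 1 / 4)
        rw [← hw] at h
        linarith [show w / (1 / 4) = 4 * w by ring]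
      have hC₃w : C₃ ≤ w := by rw [hw]; exact hNC₃
      have hw2 : 1 ≤ w ^ 2 := one_le_pow₀ hw1
      have hX₁ : X₀ + (N : ℝ) ^ ((1 : ℝ) / u) + 1 ≤ (X₀ + 2) * w ^ 2 := by
        have h := le_mul_of_one_le_right hX₀0 hw2
        linarith
      have hF : L * Real.log N + B + u ≤ (4 * L + B + u) * w := by
        have h1 : (L : ℝ) * Real.log N ≤ L * (4 * w) := mul_le_mul_of_nonneg_left hℓw hL0
        have h2 : B ≤ B * w := le_mul_of_one_le_right hB0.le hw1
        have h3 : (u : ℝ) ≤ u * w := le_mul_of_one_le_right hu0.le hw1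
        linarith
      have hX₁0 : 0 ≤ X₀ + (N : ℝ) ^ ((1 : ℝ) / u) + 1 := by positivity
      have hC₃κ : (X₀ + 2) * (4 * L + B + u) = C₃ * κ := by
        rw [hC₃, div_mul_cancel₀ _ hκ.ne']
      calc (X₀ + (N : ℝ) ^ ((1 : ℝ) / u) + 1) * (L * Real.log N + B + u)
          ≤ ((X₀ + 2) * w ^ 2) * ((4 * L + B + u) * w) :=
            mul_le_mul hX₁ hF (by positivity) (by positivity)
        _ = ((X₀ + 2) * (4 * L + B + u)) * w ^ 3 := by ring
        _ = (C₃ * κ) * w ^ 3 := by rw [hC₃κ]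
        _ ≤ (w * κ) * w ^ 3 :=
            mul_le_mul_of_nonneg_right (mul_le_mul_of_nonneg_right hC₃w hκ.le) (by positivity)
        _ = κ * N := by rw [hNw]; ring
    have hS : (if i = 0 then Y / Real.log Y else 0 : ℝ) ≤
        (X₀ + (N : ℝ) ^ ((1 : ℝ) / u) + 1) * u / Real.log N := by
      refine hSY.trans (div_le_div_of_nonneg_right ?_ hℓ0.le)
      exact mul_le_mul_of_nonneg_right (by linarith) hu0.le
    exact loa_case1 hφ0 hℓ0 hφL ha0 (haX.trans hXsmall) hX0 hXsmall hIu0 hIuB hS0 hS hC1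

/-! ## The registered stub (name and statement EXACTLY as registered) -/

/-- **`stub_lawOneAnalytic`: `APCellAsymptotic → SegmentLawOne`** (unfolded). Alladi's Ω-cell asymptotic for
the rough integers of a fixed residue class (the hypothesis, `(X, Y)`-format, little-o, uniform in the reduced
class) implies the segment law for one progression: differences of the class asymptotic at the two ends of the
segment (`loa_count_split`), the threshold `N^{1/u} < P⁻(m) ↔ ⌊N^{1/u}⌋₊ + 1 ≤ P⁻(m)` (`loa_thr_iff`),
continuity and boundedness of the densities `I_j` (`DensityCalculus`, through `calc_continuous`), positivity of
`I_j(u)` for `j < u` (`calc_pos`, giving the relative form), and the pointwise defect bound `loa_pointwise`. -/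
theorem stub_lawOneAnalytic :
    (∀ q : ℕ, 1 ≤ q → ∀ i k : ℕ, ∀ ε : ℝ, 0 < ε → ∃ X₀ : ℝ, ∀ r : ℕ, r.Coprime q →
      ∀ X Y : ℝ, 2 ≤ Y → Y ≤ X → X₀ ≤ X → Real.log X ≤ k * Real.log Y →
        |((((Finset.Icc 1 ⌊X⌋₊).filter (fun n => n ≡ r [MOD q] ∧ ⌈Y⌉₊ ≤ Nat.minFac n ∧
              ArithmeticFunction.cardFactors n = i + 1)).card : ℕ) : ℝ) -
            (X * cellDensity i (Real.log X / Real.log Y) / Real.log X -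
                if i = 0 then Y / Real.log Y else 0) / (Nat.totient q : ℝ)| ≤
          ε * X / Real.log Y) →
(∀ (L u : ℕ), 2 ≤ u → ∀ η : ℝ, 0 < η → ∀ ε : ℝ, 0 < ε → ∃ N₀ : ℕ, ∀ N : ℕ, N₀ ≤ N →
      ∀ q r : ℕ, 1 ≤ q → q ≤ L → r.Coprime q → ∀ M₁ M₂ : ℕ, M₁ ≤ M₂ → (M₂ : ℝ) ≤ L * N →
      η * N ≤ (M₂ : ℝ) - M₁ → ∀ j : ℕ, 1 ≤ j → j ≤ u →
        |((((Finset.Ioc M₁ M₂).filter (fun m => m ≡ r [MOD q] ∧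
              (N : ℝ) ^ ((1 : ℝ) / u) < (Nat.minFac m : ℝ) ∧ ArithmeticFunction.cardFactors m = j)).card : ℕ) : ℝ) -
            ((M₂ : ℝ) - M₁) / ((Nat.totient q : ℝ) * Real.log N) * cellDensity (j - 1) u| ≤
          ε * (((M₂ : ℝ) - M₁) / ((Nat.totient q : ℝ) * Real.log N)) * (if j < u then cellDensity (j - 1) u else 1)) := by
  intro H L u hu η hη ε hε
  obtain ⟨c, hc0, hc1, hcI⟩ := loa_dens_lower hu
  obtain ⟨N₀, hN₀⟩ := loa_pointwise H L u hu (show 0 < ε * c * η / 2 by positivity)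
  refine ⟨N₀, ?_⟩
  intro N hN q r hq hqL hr M₁ M₂ hM hM₂ hηN j hj hju
  obtain ⟨i, rfl⟩ : ∃ i, j = i + 1 := ⟨j - 1, by omega⟩
  simp only [Nat.add_sub_cancel]
  obtain ⟨hN2, hkey⟩ := hN₀ N hN
  have hi : i < u := by omega
  have hM' : (M₁ : ℝ) ≤ M₂ := by exact_mod_cast hM
  have hM₁ : (M₁ : ℝ) ≤ L * N := hM'.trans hM₂
  have E₂ := hkey q r hq hqL hr i hi M₂ hM₂
  have E₁ := hkey q r hq hqL hr i hi M₁ hM₁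
  clear hkey hN₀ H
  have hφ0 : (0 : ℝ) < (Nat.totient q : ℝ) := by exact_mod_cast Nat.totient_pos.mpr (by omega)
  have hℓ0 : 0 < Real.log N := Real.log_pos (by exact_mod_cast (show 1 < N by omega))
  rw [loa_count_split _ hM]
  generalize ((((Finset.Icc 1 M₂).filter (fun m => m ≡ r [MOD q] ∧
      (N : ℝ) ^ ((1 : ℝ) / u) < (Nat.minFac m : ℝ) ∧ ArithmeticFunction.cardFactors m = i + 1)).card : ℕ) : ℝ)
      = A₂ at E₂ ⊢
  generalize ((((Finset.Icc 1 M₁).filter (fun m => m ≡ r [MOD q] ∧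
      (N : ℝ) ^ ((1 : ℝ) / u) < (Nat.minFac m : ℝ) ∧ ArithmeticFunction.cardFactors m = i + 1)).card : ℕ) : ℝ)
      = A₁ at E₁ ⊢
  generalize (if i = 0 then (((⌊(N : ℝ) ^ ((1 : ℝ) / u)⌋₊ + 1 : ℕ) : ℝ)) /
      Real.log (((⌊(N : ℝ) ^ ((1 : ℝ) / u)⌋₊ + 1 : ℕ) : ℝ)) else 0 : ℝ) = S at E₁ E₂
  generalize (Nat.totient q : ℝ) = φ at hφ0 E₁ E₂ ⊢
  generalize Real.log N = ℓ at hℓ0 E₁ E₂ ⊢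
  have hdiff : A₂ - A₁ - ((M₂ : ℝ) - M₁) / (φ * ℓ) * cellDensity i u =
      (A₂ - M₂ * cellDensity i u / (φ * ℓ) + S / φ) - (A₁ - M₁ * cellDensity i u / (φ * ℓ) + S / φ) := by ring
  rw [hdiff]
  have hsum : |(A₂ - M₂ * cellDensity i u / (φ * ℓ) + S / φ) - (A₁ - M₁ * cellDensity i u / (φ * ℓ) + S / φ)| ≤
      ε * c * η / 2 * N / (φ * ℓ) + ε * c * η / 2 * N / (φ * ℓ) :=
    (abs_sub _ _).trans (add_le_add E₂ E₁)
  have hφℓ : 0 < φ * ℓ := mul_pos hφ0 hℓ0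
  have hΛ0 : 0 ≤ ((M₂ : ℝ) - M₁) / (φ * ℓ) := div_nonneg (by linarith) hφℓ.le
  have hcle : c ≤ (if i + 1 < u then cellDensity i u else 1) := by
    split_ifs with h
    · exact hcI i h
    · exact hc1
  calc |(A₂ - M₂ * cellDensity i u / (φ * ℓ) + S / φ) - (A₁ - M₁ * cellDensity i u / (φ * ℓ) + S / φ)|
      ≤ ε * c * η / 2 * N / (φ * ℓ) + ε * c * η / 2 * N / (φ * ℓ) := hsum
    _ = ε * c * (η * N) / (φ * ℓ) := by ring
    _ ≤ ε * c * ((M₂ : ℝ) - M₁) / (φ * ℓ) :=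
        div_le_div_of_nonneg_right (mul_le_mul_of_nonneg_left hηN (by positivity)) hφℓ.le
    _ = ε * (((M₂ : ℝ) - M₁) / (φ * ℓ)) * c := by ring
    _ ≤ ε * (((M₂ : ℝ) - M₁) / (φ * ℓ)) * (if i + 1 < u then cellDensity i u else 1) :=
        mul_le_mul_of_nonneg_left hcle (by positivity)

end Summit.Parity.GeneralizedHardyLittlewood.Cruxes.FibreHyperbolicity.ModelTransfer
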